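import Mathlib

/-!
# Bordered residual identities (solo-blind, PLATEAU (PL-1′)(b)(iv), paper §24.95(1))

The slow eigenvalue of the ideal chain is computed from the `r₁`-bordered form of the
eigenproblem: unknown vector `(1, w)` (first component normalised), matrix with corner `a`,
first row `row`, first column `col` and complement block `C`.  If `(1, w)` is an eigenvector
with eigenvalue `λ` then `λ = a + row ⬝ᵥ w` and `(C - λ) w = -col`.  Given an explicit
ANSATZ `wa` and a candidate value `α` with residuals
`res₁ := a + row ⬝ᵥ wa - α` and `res_c := col + C wa - α wa`, the correction `δ := w - wa`
satisfies the exact identities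

* `C δ - λ δ = -res_c + (λ - α) wa`   (complement equation),
* `λ - α = res₁ + row ⬝ᵥ δ`           (bordered row),

which are the bookkeeping behind the componentwise discrete-WKB argument: bound `δ` from the
first identity by a banded-recursion / Volterra comparison, insert into the second.
Pure algebra over a commutative ring; no inverses.
-/

namespace Summit.AnomalousDissipation.AnomalousDissipation.Theorems

open Matrix

variable {ι K : Type*} [Fintype ι] [CommRing K]

/-- Complement equation for the correction `δ = w - wa` of an ansatz `wa`:
if `C w - λ w = -col` then `C (w - wa) - λ (w - wa) = -(col + C wa - α wa) + (λ - α) wa`. -/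
theorem bordered_complement_identity (C : Matrix ι ι K) (col w wa : ι → K) (α lam : K)
    (h2 : C.mulVec w - lam • w = -col) :
    C.mulVec (w - wa) - lam • (w - wa) = -(col + C.mulVec wa - α • wa) + (lam - α) • wa := by
  have h2' : C.mulVec w = lam • w - col := by
    linear_combination h2
  rw [Matrix.mulVec_sub, h2']
  ext i
  simp only [Pi.sub_apply, Pi.smul_apply, Pi.add_apply, Pi.neg_apply, smul_eq_mul]
  ring

/-- Bordered-row identity: if `λ = a + row ⬝ᵥ w` then for any ansatz `wa` and candidate `α`,
`λ - α = (a + row ⬝ᵥ wa - α) + row ⬝ᵥ (w - wa)`. -/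
theorem bordered_row_identity (row w wa : ι → K) (a α lam : K) (h1 : lam = a + row ⬝ᵥ w) :
    lam - α = (a + row ⬝ᵥ wa - α) + row ⬝ᵥ (w - wa) := by
  rw [h1, dotProduct_sub]
  ring

/-- The eigen-equations of the bordered matrix in block form: if the full vector `(1, w)` satisfies
the corner row `a * 1 + row ⬝ᵥ w = λ * 1` and the complement rows `col * 1 + C w = λ w`, then the
two hypotheses of the identities above hold. (Trivial repackaging, recorded so that the chain's
normalisation `r₁ = 1` is explicit.) -/
theorem bordered_hypotheses_of_eigen (C : Matrix ι ι K) (row col w : ι → K) (a lam : K)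
    (hc : a + row ⬝ᵥ w = lam) (hC : col + C.mulVec w = lam • w) :
    lam = a + row ⬝ᵥ w ∧ C.mulVec w - lam • w = -col := by
  refine ⟨hc.symm, ?_⟩
  linear_combination hC

/-- Consequence used for the eigenvalue enclosure: if the bordered functional of the correction is
controlled, `row ⬝ᵥ (w - wa) = θ * (lam - α) + e` (the part proportional to `λ - α` comes from the
`(λ - α) wa` forcing in the complement equation, `e` from `res_c`), and `1 - θ` is a unit, then
`λ - α = (res₁ + e) / (1 - θ)` exactly. -/
theorem bordered_eigenvalue_defect (row w wa : ι → K) (a α lam θ e u : K)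
    (h1 : lam = a + row ⬝ᵥ w) (hf : row ⬝ᵥ (w - wa) = θ * (lam - α) + e)
    (hu : u * (1 - θ) = 1) :
    lam - α = u * ((a + row ⬝ᵥ wa - α) + e) := by
  have key := bordered_row_identity row w wa a α lam h1
  rw [hf] at key
  -- key : lam - α = (a + row ⬝ᵥ wa - α) + (θ * (lam - α) + e)
  have h3 : (lam - α) * (1 - θ) = (a + row ⬝ᵥ wa - α) + e := by
    linear_combination key
  calc lam - α = (lam - α) * ((1 - θ) * u) := by rw [mul_comm (1 - θ) u, hu, mul_one]
    _ = u * ((lam - α) * (1 - θ)) := by ring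
    _ = u * ((a + row ⬝ᵥ wa - α) + e) := by rw [h3]

end Summit.AnomalousDissipation.AnomalousDissipation.Theorems
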